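import Summits.CriticalPhenomena.PercolationContinuityZ3.Theorems.PercNearOneGluingNoHeavyLowerTailSunflowerBKStratum
import HarnessLib

/-!
# `NoHeavyLowerTail` (crux stmt-CriticalPhenomena-4575), abstract sunflower cubic: the `K`-PETAL disjoint-occurrence stratum —
# the a-sheet inequality `Π_i μ(E_i) ≤ μ(A)^{K−1}` whenever the last petal witnesses the core shadows of the other `K − 1` petals
# on pairwise disjoint sets of present coordinates (iterated van den Berg–Kesten)

Support file (seat `prim-ineq-gen-2` gen 31; `--supports stmt-CriticalPhenomena-4575`; companion of `…SunflowerBKStratum`).  Nothing is asserted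
about the crux; no `sorry`, no named facts, standard axioms.  Memo: run/shared/lean/prim/prim-ineq-gen-2/BK-STRATUM-GEN31.md §1.

prove-1's `K`-petal a-sheet CONJECTURE (FINDING-KPETAL-prove1-g30, `…SunflowerPrincipalCore`): for a `K`-petal sunflower of up-sets with core `A`,
`a ≥ b ⟹ Π_i μ(E_i) ≤ μ(A)^{K−1}` (proved there for principal cores).  THIS FILE proves the inequality UNCONDITIONALLY IN `p` on the iterated BK
stratum: with `G_i := coreShadow E_i A` (largest up-set meeting `E_i` inside `A`),
* `lemmaA_list_of_bk` — for a list `l` of up-sets and events `E, A` with `E ⊆ G_{l₁} □ (G_{l₂} □ (⋯ □ univ))` (`disjointOccurrenceList`):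
  `(Π_{E' ∈ l} μ(E')) · μ(E) ≤ μ(A)^{|l|}` — Harris `μ(G_i)μ(E_i) ≤ μ(A)` for each listed petal and the iterated BK inequality
  `μ(E) ≤ Π μ(G_i)` (`Literature…prodBernoulli_bk_list`).  For `|l| = 2` this is `…BKStratum.lemmaA_of_bk` (up to `□ univ`).
* `isFinitary_of_fintype'` — bookkeeping: on a finite index type every event is finitary.
-/

noncomputable section

namespace Summit.CriticalPhenomena.PercolationContinuityZ3.Theorems.SunflowerPartition

namespace BKStratum

open MeasureTheory
open Literature.Probability.LatticeModels Literature.Probability.Percolation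

variable {ι : Type*}

/-- On a finite index type every event is finitary (each member is itself a finite witness). [folklore] -/
theorem isFinitary_of_fintype' [Fintype ι] (X : Set (Set ι)) : IsFinitary X := by
  classical
  intro ω hω
  exact ⟨(Set.toFinite ω).toFinset, by simp, by simpa using hω⟩

/-- The product of the Harris steps: `Π_{E' ∈ l} (μ(coreShadow E' A) · μ(E')) ≤ μ(A)^{|l|}` for a list of up-sets. [this work] -/
theorem prod_coreShadow_mul_le [Fintype ι] (p : ι → unitInterval) (A : Set (Set ι)) (l : List (Set (Set ι)))
    (hl : ∀ E' ∈ l, IsUpperSet E') :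
    (l.map fun E' => (prodBernoulli p).real (coreShadow E' A) * (prodBernoulli p).real E').prod ≤
      ((prodBernoulli p).real A) ^ l.length := by
  induction l with
  | nil => simp
  | cons E' l ih =>
    rw [List.map_cons, List.prod_cons, List.length_cons, pow_succ']
    have h1 : (prodBernoulli p).real (coreShadow E' A) * (prodBernoulli p).real E' ≤ (prodBernoulli p).real A :=
      real_coreShadow_mul_real_le p (hl E' (by simp)) A
    have h2 := ih fun E'' hE'' => hl E'' (by simp [hE''])
    have hnn : 0 ≤ (l.map fun E' => (prodBernoulli p).real (coreShadow E' A) * (prodBernoulli p).real E').prod :=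
      List.prod_nonneg fun x hx => by
        obtain ⟨E'', -, rfl⟩ := List.mem_map.1 hx
        exact mul_nonneg measureReal_nonneg measureReal_nonneg
    exact mul_le_mul h1 h2 hnn measureReal_nonneg

/-- **`K`-petal Lemma A on the iterated BK stratum.**  If the event `E` witnesses the core shadows of the up-sets in `l` on pairwise disjoint sets of
present coordinates, `E ⊆ G_{l₁} □ (G_{l₂} □ ⋯)`, then `(Π_{E' ∈ l} μ(E')) · μ(E) ≤ μ(A)^{|l|}` under every product measure. [this work] -/
theorem lemmaA_list_of_bk [Fintype ι] (p : ι → unitInterval) {E A : Set (Set ι)} (l : List (Set (Set ι)))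
    (hl : ∀ E' ∈ l, IsUpperSet E') (hbk : E ⊆ disjointOccurrenceList (l.map fun E' => coreShadow E' A)) :
    (l.map fun E' => (prodBernoulli p).real E').prod * (prodBernoulli p).real E ≤ ((prodBernoulli p).real A) ^ l.length := by
  classical
  set μ := prodBernoulli p with hμ
  -- iterated BK: `μ(E) ≤ Π μ(G_i)`
  have hup : ∀ X ∈ l.map (fun E' => coreShadow E' A), IsUpperSet X := by
    intro X hX
    obtain ⟨E', -, rfl⟩ := List.mem_map.1 hX
    exact isUpperSet_coreShadow E' A
  have hfin : ∀ X ∈ l.map (fun E' => coreShadow E' A), IsFinitary X := fun X _ => isFinitary_of_fintype' X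
  have hBK : μ.real E ≤ ((l.map fun E' => coreShadow E' A).map μ.real).prod :=
    (measureReal_mono hbk).trans (prodBernoulli_bk_list p _ hup hfin)
  rw [List.map_map] at hBK
  -- combine with the Harris steps
  have hE : 0 ≤ (l.map fun E' => μ.real E').prod :=
    List.prod_nonneg fun x hx => by
      obtain ⟨E'', -, rfl⟩ := List.mem_map.1 hx
      exact measureReal_nonneg
  have hprod : (l.map fun E' => μ.real E').prod * (l.map (μ.real ∘ fun E' => coreShadow E' A)).prod =
      (l.map fun E' => μ.real (coreShadow E' A) * μ.real E').prod := by
    rw [← List.prod_map_mul]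
    congr 1
    refine List.map_congr_left fun E' _ => ?_
    simp only [Function.comp]
    ring
  calc (l.map fun E' => μ.real E').prod * μ.real E
      ≤ (l.map fun E' => μ.real E').prod * (l.map (μ.real ∘ fun E' => coreShadow E' A)).prod :=
        mul_le_mul_of_nonneg_left hBK hE
    _ = (l.map fun E' => μ.real (coreShadow E' A) * μ.real E').prod := hprod
    _ ≤ (μ.real A) ^ l.length := prod_coreShadow_mul_le p A l hl

/-- The three-petal case recovered: `E₃ ⊆ G₁ □ (G₂ □ univ) ⟹ μ(E₁)μ(E₂)μ(E₃) ≤ μ(A)²`. [this work] -/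
theorem lemmaA_of_bk_list_two [Fintype ι] (p : ι → unitInterval) {E₁ E₂ E₃ A : Set (Set ι)} (h₁ : IsUpperSet E₁)
    (h₂ : IsUpperSet E₂) (hbk : E₃ ⊆ coreShadow E₁ A □ (coreShadow E₂ A □ Set.univ)) :
    (prodBernoulli p).real E₁ * (prodBernoulli p).real E₂ * (prodBernoulli p).real E₃ ≤ ((prodBernoulli p).real A) ^ 2 := by
  have hl : ∀ E' ∈ [E₁, E₂], IsUpperSet E' := by
    intro E' hE'
    simp only [List.mem_cons, List.not_mem_nil, or_false] at hE'
    rcases hE' with rfl | rfl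
    · exact h₁
    · exact h₂
  have h := lemmaA_list_of_bk p [E₁, E₂] hl (by simpa using hbk)
  simpa [mul_assoc] using h

end BKStratum

end Summit.CriticalPhenomena.PercolationContinuityZ3.Theorems.SunflowerPartition

end
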